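import Summits.ResolutionOfSingularities.ResolutionOfSingularities.Theorems.WallFrames6
import Summits.ResolutionOfSingularities.ResolutionOfSingularities.Theorems.NearCutCompanion3
import Summits.ResolutionOfSingularities.ResolutionOfSingularities.Theorems.NearCutWalls2
import Summits.ResolutionOfSingularities.ResolutionOfSingularities.Theorems.ProximityCutArcLaw
import Summits.ResolutionOfSingularities.ResolutionOfSingularities.Theorems.MaxContactCutBoundaryLedger
import Summits.ResolutionOfSingularities.ResolutionOfSingularities.Theorems.MaxContactCutWallCut
import Summits.ResolutionOfSingularities.ResolutionOfSingularities.Theorems.PlanarGhostDescent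
import Summits.ResolutionOfSingularities.ResolutionOfSingularities.Theorems.ExitLawStates
import Literature.AlgebraicGeometry.Resolution.PointBlowupIFPGiraud
import Literature.AlgebraicGeometry.Resolution.AdicNoetherian
import HarnessLib

/-!
# WallFrames (7/17) — Kollár's wall descent in a polynomial frame; sections: IsolationTop (cont.), Presentation

Verbatim slice of the farm-checked monolith `WallFrames.lean` of cell `decomp-res`, seat `decomp-res-lens-5`, g35
(sha256 7405a21d81d102a4…, monolith lines 1612–1874); one namespace `Summit.ResolutionOfSingularities.ResolutionOfSingularities.Theorems.WallFrames` across the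
slices, imports chained.  The monolith's module docstring (laws W1–W7, mechanism, novelty, honest placement) is
reproduced in slice 1; the main theorem `balancedWallPort_holds : WallCut.BalancedWallPort` (hypothesis-free) and the
host-route corollary `ecBalancedWallPort_holds` (aside item 27368 of route MaxContactCut) are in slice 16/17.
-/

open MvPolynomial Finset
open scoped BigOperators
open Literature.AlgebraicGeometry.Resolution
open Literature.AlgebraicGeometry.Resolution.Hauser2010
open Literature.AlgebraicGeometry.Resolution.PointBlowup
open Literature.AlgebraicGeometry.Resolution.HauserPerlega2024

namespace Summit.ResolutionOfSingularities.ResolutionOfSingularities.Theorems.WallFrames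

variable {σ : Type*} [Fintype σ] [DecidableEq σ] {K : Type*} [Field K]

section IsolationTop

variable {τ : Type} [DecidableEq τ] {L : Type} [Field L] [DecidableEq L]

omit [DecidableEq L] in
/-- **K3 CONTRADICTION LAW WITH REMAINDER.**  A unit times `y_u^M` is not in `𝔓 + (y_u^Λ)` when `M < Λ`. [new] -/
theorem not_mem_frame_sup_far {u v z : τ} (huv : u ≠ v) (huz : u ≠ z) (hvz : v ≠ z)
    {ζ : MvPolynomial τ L} (hζ : (∀ μ ∈ ζ.support, μ z = 0)) (hζ1 : (1 : ℕ∞) ≤ ordZero ζ)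
    {g : MvPolynomial τ L} (hg : constantCoeff g ≠ 0) {M Λ : ℕ} (hMΛ : M < Λ) :
    g * X u ^ M ∉ Ideal.span {(X v : MvPolynomial τ L), X z - ζ} ⊔ Ideal.span {X u ^ Λ} := by
  classical
  intro hmem
  obtain ⟨φ, hφv, hφz, hφu, hφc⟩ := exists_frameKill huv huz hvz hζ hζ1
  obtain ⟨a, ha, b, hb, hab⟩ := Submodule.mem_sup.mp hmem
  obtain ⟨c, rfl⟩ := Ideal.mem_span_singleton'.mp hb
  have hker : Ideal.span {(X v : MvPolynomial τ L), X z - ζ} ≤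
      RingHom.ker (φ : MvPolynomial τ L →+* MvPolynomial τ L) := by
    rw [Ideal.span_le]
    rintro x hx
    rcases hx with rfl | rfl
    · exact hφv
    · simpa using hφz
  have ha0 : φ a = 0 := by
    have h := hker ha
    rwa [RingHom.mem_ker, RingHom.coe_coe] at h
  have heq : φ g * X u ^ M = φ c * X u ^ Λ := by
    have h := congrArg φ hab
    rw [map_add, ha0, zero_add, map_mul, map_mul, map_pow, map_pow, hφu] at h
    exact h.symm
  -- compare the coefficient of `y_u^M`
  have h1 : coeff (Finsupp.single u M) (φ g * X u ^ M) = constantCoeff g := by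
    rw [X_pow_eq_monomial, coeff_mul_monomial', if_pos le_rfl, tsub_self, mul_one, ← hφc g]; rfl
  have h2 : coeff (Finsupp.single u M) (φ c * X u ^ Λ) = 0 := by
    rw [X_pow_eq_monomial, coeff_mul_monomial', if_neg]
    rw [Finsupp.single_le_iff, Finsupp.single_eq_same]
    omega
  rw [heq, h2] at h1
  exact hg h1.symm

end IsolationTop

/-! ## §11 Unit-weighted presentations: EXACT set dynamics of Kollár's supports in a polynomial frame (W5 + W7)

The frame expansion is carried as a PRESENTATION `P = Σ_{n ∈ S} y^n · U_n + R` with UNITS `U_n` (`U_n(0) ≠ 0`) and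
a wall-deep remainder `R`.  Both move types transport presentations termwise: a lost-wall move by the monomial map
`cT_s^j` (`y^n U ↦ y^{χ(n)} · cT_0^j U`, §2), a free-chart move by the rotation substitution `Ψ` (§8), which sends
`y_u^A y_v^B Z^k · U` to `y_E^s · (y_u^A y_E^{A+B+k-s} V^k · U' + F)` with the NEW UNIT
`U' = Ψ(U) · (V + β + ζ'')^B · Q̃^k` and `F ∈ (r_g)` wall-deep.  Hence the index set moves EXACTLY, `S_{t+1} = step(S_t)`
(Kollár's K1a/K1b AS SETS, births absorbed into units), the support of `P` is sandwiched between the minimal elements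
of `S` (which carry the non-zero coefficients `U_n(0)`) and the up-closure of `S` plus far terms, so K2 (from
`ordZero`) holds on all of `S` and K3 (§7, §10) reads off `S`.  This replaces Weierstrass preparation over `K[[u,v]]`. -/

section Presentation

omit [Fintype σ] in
/-- **SANDWICH (upper).** Every support monomial of `Σ_{n∈S} y^n U_n` dominates some `n ∈ S`. [folklore] -/
theorem exists_le_of_mem_support_presentation {α : Type*} (A : Finset α) (ι : α → σ →₀ ℕ)
    (U : α → MvPolynomial σ K) {d : σ →₀ ℕ} (hd : d ∈ (∑ a ∈ A, monomial (ι a) (1 : K) * U a).support) :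
    ∃ a ∈ A, ι a ≤ d := by
  classical
  obtain ⟨a, ha, hda⟩ := Finset.mem_biUnion.mp (support_sum hd)
  refine ⟨a, ha, ?_⟩
  by_contra hle
  rw [mem_support_iff, coeff_monomial_mul', if_neg hle] at hda
  exact hda rfl

omit [Fintype σ] [DecidableEq σ] in
/-- **SANDWICH (lower).** A MINIMAL index `n₀ ∈ S` not met by the remainder carries the coefficient `U_{n₀}(0)`
(so it lies in the support when `U_{n₀}` is a unit): Kollár's K1a for minimal points. [new] -/
theorem coeff_presentation_of_minimal {α : Type*} (A : Finset α) (ι : α → σ →₀ ℕ)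
    (U : α → MvPolynomial σ K) (R : MvPolynomial σ K) {a₀ : α} (ha₀ : a₀ ∈ A)
    (hmin : ∀ a ∈ A, ι a ≤ ι a₀ → a = a₀) (hR : coeff (ι a₀) R = 0) :
    coeff (ι a₀) (∑ a ∈ A, monomial (ι a) (1 : K) * U a + R) = constantCoeff (U a₀) := by
  classical
  rw [coeff_add, hR, add_zero, coeff_sum, Finset.sum_eq_single a₀]
  · rw [coeff_monomial_mul', if_pos le_rfl, one_mul, tsub_self]; rfl
  · intro a ha hne
    rw [coeff_monomial_mul', if_neg (fun h => hne (hmin a ha h))]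
  · exact fun h => absurd ha₀ h

-- writer g14: `eq_of_le_of_degree_le` deleted — identical landed twin `ExitLaw.eq_of_le_of_degree_le` (Theorems/ExitLawStates, now imported); use site cites it.

omit [Fintype σ] [DecidableEq σ] in
/-- **K2 ON PRESENTATIONS.**  If `P = Σ_{n ∈ S} yⁿ·U_n + R` with units `U_n`, a remainder with monomials of degree
`≥ s`, and `ord P ≥ s`, then EVERY index of `S` has degree `≥ s` — also the non-minimal ("phantom") ones, which sit
above a minimal index that is a genuine monomial of `P`.  In the walk this is Kollár's K2 (`a + b ≥ −i`) for all points
of the exact orbit family, fed by `ord G_t = s` (nearness) at every stage. [new] [Kollar2007 2.59.4 (ii)] -/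
theorem degree_ge_of_mem_presentation {α : Type*} (A : Finset α) (ι : α → σ →₀ ℕ)
    (U : α → MvPolynomial σ K) (R : MvPolynomial σ K) (hι : ∀ a ∈ A, ∀ a' ∈ A, ι a = ι a' → a = a')
    (hU : ∀ a ∈ A, constantCoeff (U a) ≠ 0) {s : ℕ} (hR : ∀ d ∈ R.support, s ≤ d.degree)
    (hP : (s : ℕ∞) ≤ ordZero (∑ a ∈ A, monomial (ι a) (1 : K) * U a + R)) : ∀ a ∈ A, s ≤ (ι a).degree := by
  classical
  intro n hn
  set S' := A.filter (fun x => ι x ≤ ι n) with hS'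
  have hnS' : n ∈ S' := by rw [hS', Finset.mem_filter]; exact ⟨hn, le_rfl⟩
  obtain ⟨m, hm, hmin⟩ := S'.exists_min_image (fun x => (ι x).degree) ⟨n, hnS'⟩
  rw [hS', Finset.mem_filter] at hm
  obtain ⟨hmS, hmn⟩ := hm
  have hdeg_mn : (ι m).degree ≤ (ι n).degree := by
    have hsplit : ι n = ι m + (ι n - ι m) := (add_tsub_cancel_of_le hmn).symm
    rw [hsplit, map_add]; omega
  refine le_trans ?_ hdeg_mn
  by_cases hRm : coeff (ι m) R = 0
  · have hminimal : ∀ x ∈ A, ι x ≤ ι m → x = m := by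
      intro x hx hxm
      have hxS' : x ∈ S' := by rw [hS', Finset.mem_filter]; exact ⟨hx, hxm.trans hmn⟩
      exact hι x hx m hmS (ExitLaw.eq_of_le_of_degree_le hxm (hmin x hxS'))
    have hcoeff := coeff_presentation_of_minimal A ι U R hmS hminimal hRm
    by_contra hlt
    push Not at hlt
    have hlt' : ((ι m).degree : ℕ∞) < ordZero (∑ a ∈ A, monomial (ι a) (1 : K) * U a + R) :=
      lt_of_lt_of_le (by exact_mod_cast hlt) hP
    rw [coeff_eq_zero_of_degree_lt_ordZero hlt'] at hcoeff
    exact hU m hmS hcoeff.symm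
  · exact hR (ι m) (mem_support_iff.mpr hRm)

omit [Fintype σ] in
/-- **LOST-WALL PRESENTATION TRANSPORT.** `cT_s^j (y^n · U) = y^{χ_s^j(n)} · cT_0^j U` for `|n| ≥ s`; the new
cofactor is again a unit (`constantCoeff_chartTransform_zero`). [new] -/
theorem chartTransform_monomial_mul (j : σ) {s : ℕ} {n : σ →₀ ℕ} (hn : s ≤ n.degree) (U : MvPolynomial σ K) :
    chartTransform s j (monomial n (1 : K) * U) = monomial (chartExponent s j n) 1 * chartTransform 0 j U := by
  have hmon : (s : ℕ∞) ≤ ordZero (monomial n (1 : K) : MvPolynomial σ K) :=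
    le_trans (by exact_mod_cast hn) (le_ordZero_of_isHomogeneous (isHomogeneous_monomial (1 : K) rfl))
  have hU : ((0 : ℕ) : ℕ∞) ≤ ordZero U := by simp
  have h := NearCut.chartTransform_mul_of_le j hmon hU
  rw [Nat.add_zero] at h
  rw [h, chartTransform_monomial]

omit [Fintype σ] in
/-- **PRESENTATION TRANSPORT (lost-wall move, packaged).**  A unit-weighted presentation
`σ_ζ G = Σ_{n ∈ S} y^n·U_n + R` of the sheared companion is carried by the move `(chart j ≠ z, centre b = b_z e_z)` to
the presentation `σ_{ζ'} G' = Σ_{n ∈ S} y^{χ n}·cT_0^j U_n + cT_s^j R` of the new sheared companion, `ζ' = cT_1^j ζ − b_z`: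
SAME index set re-indexed by the toric map `χ = chartExponent s j` (presentations are indexed by an arbitrary finite
label set `A` with an index map `ι`, so that moves compose by composing index maps), units transported by `cT_0^j` (constant terms kept,
`constantCoeff_chartTransform_zero`), far part transported (`far_chartTransform`).  This is the exact coefficient
dynamics (K1) with no loss. [new] -/
theorem presentation_transport {z j : σ} (hjz : j ≠ z) {ζ : MvPolynomial σ K} (hζ1 : (1 : ℕ∞) ≤ ordZero ζ)
    {b : σ → K} (hb : ∀ i, i ≠ z → b i = 0) {s : ℕ} {G : MvPolynomial σ K} (hG : (s : ℕ∞) ≤ ordZero G)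
    {α : Type*} {A : Finset α} {ι : α → σ →₀ ℕ} {U : α → MvPolynomial σ K} {R : MvPolynomial σ K}
    (hS : ∀ a ∈ A, s ≤ (ι a).degree) (hpres : zshear z ζ G = ∑ a ∈ A, monomial (ι a) 1 * U a + R) :
    zshear z (chartTransform 1 j ζ - C (b z)) (PointBlowup.translate b (chartTransform s j G)) =
      ∑ a ∈ A, monomial (chartExponent s j (ι a)) 1 * chartTransform 0 j (U a) + chartTransform s j R := by
  rw [transport_law hjz hζ1 hb hG, hpres, chartTransform_add, chartTransform_sum]
  refine congrArg (· + _) (Finset.sum_congr rfl fun a ha => ?_)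
  exact chartTransform_monomial_mul j (hS a ha) (U a)

omit [Fintype σ] in
/-- `cT_0^j` preserves constant coefficients (units stay units). [folklore] -/
theorem constantCoeff_chartTransform_zero (j : σ) (U : MvPolynomial σ K) :
    constantCoeff (chartTransform 0 j U) = constantCoeff U := by
  have h := X_pow_mul_chartTransform j (a := 0) (P := U) (by simp)
  rw [pow_zero, one_mul] at h
  rw [h]
  refine constantCoeff_aeval_of_forall (fun i => ?_) U
  by_cases hi : i = j
  · simp [hi]
  · simp [hi]

/-- The rotation substitution of a free-chart move on the expansion variables (kept wall `u`, new wall letter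
`z`, new frame letter `v`): `y_u ↦ y_u y_z`, `y_v ↦ y_z (y_v + β + ζ'')`, `y_z ↦ y_z (Q̃ y_v + r)`. -/
noncomputable def rotSubst (u v z : σ) (β : K) (ζ₂ Q r : MvPolynomial σ K) : MvPolynomial σ K →ₐ[K] MvPolynomial σ K :=
  aeval fun i => if i = u then X u * X z else if i = v then X z * (X v + C β + ζ₂)
    else if i = z then X z * (Q * X v + r) else X i * X z

omit [Fintype σ] in
/-- `rotSubst_X_u`: WallFrames (lens-5 g35) computation rule; docstring added by the writer (lint.docstring) [folklore] -/
theorem rotSubst_X_u {u v z : σ} (β : K) (ζ₂ Q r : MvPolynomial σ K) :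
    rotSubst u v z β ζ₂ Q r (X u) = X u * X z := by
  unfold rotSubst; rw [aeval_X, if_pos rfl]

omit [Fintype σ] in
/-- `rotSubst_X_v`: WallFrames (lens-5 g35) computation rule; docstring added by the writer (lint.docstring) [folklore] -/
theorem rotSubst_X_v {u v z : σ} (huv : u ≠ v) (β : K) (ζ₂ Q r : MvPolynomial σ K) :
    rotSubst u v z β ζ₂ Q r (X v) = X z * (X v + C β + ζ₂) := by
  unfold rotSubst; rw [aeval_X, if_neg (Ne.symm huv), if_pos rfl]

omit [Fintype σ] in
/-- `rotSubst_X_z`: WallFrames (lens-5 g35) computation rule; docstring added by the writer (lint.docstring) [folklore] -/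
theorem rotSubst_X_z {u v z : σ} (huz : u ≠ z) (hvz : v ≠ z) (β : K) (ζ₂ Q r : MvPolynomial σ K) :
    rotSubst u v z β ζ₂ Q r (X z) = X z * (Q * X v + r) := by
  unfold rotSubst; rw [aeval_X, if_neg (Ne.symm huz), if_neg (Ne.symm hvz), if_pos rfl]

omit [Fintype σ] in
/-- `Ψ` maps every variable into the maximal ideal when `ζ''(0) = 0`, so it preserves constant coefficients. -/
theorem constantCoeff_rotSubst {u v z : σ} (β : K) {ζ₂ : MvPolynomial σ K} (hζ₂ : constantCoeff ζ₂ = 0)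
    (Q r U : MvPolynomial σ K) : constantCoeff (rotSubst u v z β ζ₂ Q r U) = constantCoeff U := by
  unfold rotSubst
  refine constantCoeff_aeval_of_forall (fun i => ?_) U
  by_cases h1 : i = u
  · rw [if_pos h1]; simp
  by_cases h2 : i = v
  · rw [if_neg h1, if_pos h2]; simp [hζ₂]
  by_cases h3 : i = z
  · rw [if_neg h1, if_neg h2, if_pos h3]; simp
  · rw [if_neg h1, if_neg h2, if_neg h3]; simp

omit [Fintype σ] in
/-- **FREE-CHART CONJUGATION LAW.**  The rotation substitution IS the free-chart move read between the two sheared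
frames: for the centre `b = β e_v`, old frame `Z = y_z − ζ` (letter `z`), rotated germ
`g'' = translate b (1 − cT₁ᶻ ζ) = Q_g (y_v − ζ'') + r_g` (new letter `v`, `ζ''`, `r_g` `v`-free),
`y_z^s · zshear_v^{ζ''}(translate b (cT_sᶻ G)) = Ψ(zshear_z^{ζ} G)` with `Ψ = rotSubst u v z β ζ'' (zshear_v^{ζ''} Q_g) r_g`.
So presentations transport termwise by `freeChart_presentation`. [new] -/
theorem freeChart_conjugation {u v z : σ} (huv : u ≠ v) (huz : u ≠ z) (hvz : v ≠ z)
    {b : σ → K} {β : K} (hbv : b v = β) (hb : ∀ i, i ≠ v → b i = 0)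
    {ζ : MvPolynomial σ K} (hζ : (∀ μ ∈ ζ.support, μ z = 0)) (hζ1 : (1 : ℕ∞) ≤ ordZero ζ)
    {ζ₂ Qg rg : MvPolynomial σ K} (hζ₂ : (∀ μ ∈ ζ₂.support, μ v = 0)) (hrg : (∀ μ ∈ rg.support, μ v = 0))
    (hg : PointBlowup.translate b (1 - chartTransform 1 z ζ) = Qg * (X v - ζ₂) + rg)
    {s : ℕ} {G : MvPolynomial σ K} (hs : (s : ℕ∞) ≤ ordZero G) :
    X z ^ s * zshear v ζ₂ (PointBlowup.translate b (chartTransform s z G)) =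
      rotSubst u v z β ζ₂ (zshear v ζ₂ Qg) rg (zshear z ζ G) := by
  classical
  -- Step 1: pull `y_z^s` inside and use the total transform `θ_z`
  have hbz : b z = 0 := hb z (Ne.symm hvz) |> fun h => by simpa using h
  have h1 : X z ^ s * zshear v ζ₂ (PointBlowup.translate b (chartTransform s z G)) =
      zshear v ζ₂ (PointBlowup.translate b (X z ^ s * chartTransform s z G)) := by
    unfold PointBlowup.translate
    rw [map_mul, map_pow, aeval_X, hbz, C_0, add_zero, map_mul, map_pow, zshear_X_of_ne (Ne.symm hvz)]
  rw [h1, X_pow_mul_chartTransform z hs]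
  -- Step 2: `G = zshear_z^{−ζ} P` with `P = zshear_z^{ζ} G`; compare algebra maps on generators
  conv_lhs => rw [← zshear_neg_zshear hζ G]
  set P := zshear z ζ G with hP
  set θ : MvPolynomial σ K →ₐ[K] MvPolynomial σ K :=
    aeval (fun i => if i = z then (X z : MvPolynomial σ K) else X z * X i) with hθ
  set τ : MvPolynomial σ K →ₐ[K] MvPolynomial σ K := aeval (fun i => X i + C (b i)) with hτ
  have hτeq : ∀ R : MvPolynomial σ K, PointBlowup.translate b R = τ R := fun R => rfl
  rw [hτeq]
  show ((zshear v ζ₂).comp (τ.comp (θ.comp (zshear z (-ζ))))) P = rotSubst u v z β ζ₂ (zshear v ζ₂ Qg) rg P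
  congr 1
  refine MvPolynomial.algHom_ext fun i => ?_
  simp only [AlgHom.comp_apply]
  -- images of `θ`, `τ` on variables
  have hθz : θ (X z) = X z := by rw [hθ, aeval_X, if_pos rfl]
  have hθi : ∀ i, i ≠ z → θ (X i) = X z * X i := fun i hi => by rw [hθ, aeval_X, if_neg hi]
  have hτi : ∀ i, i ≠ v → τ (X i) = X i := fun i hi => by rw [hτ, aeval_X, hb i hi, C_0, add_zero]
  have hτv : τ (X v) = X v + C β := by rw [hτ, aeval_X, hbv]
  by_cases hiu : i = u
  · subst hiu
    rw [rotSubst_X_u, zshear_X_of_ne huz, hθi i huz, map_mul, hτi z (Ne.symm hvz), hτi i huv, map_mul,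
      zshear_X_of_ne (Ne.symm hvz), zshear_X_of_ne huv]
    ring
  by_cases hiv : i = v
  · subst hiv
    rw [rotSubst_X_v huv, zshear_X_of_ne hvz, hθi i hvz, map_mul, hτi z (Ne.symm hvz), hτv, map_mul,
      zshear_X_of_ne (Ne.symm hvz), map_add, zshear_X_self, zshear_C]
    ring
  by_cases hiz : i = z
  · subst hiz
    have hθζ : θ ζ = X i * chartTransform 1 i ζ := by
      rw [hθ, ← X_pow_mul_chartTransform i hζ1, pow_one]
    have hg' : τ (chartTransform 1 i ζ) = 1 - (Qg * (X v - ζ₂) + rg) := by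
      have h := hg
      rw [hτeq, map_sub, map_one] at h
      rw [← h]; ring
    rw [rotSubst_X_z huz hvz, zshear_X_self, map_add, map_neg, hθz, hθζ, map_add, map_neg, map_mul,
      hτi i (Ne.symm hvz), hg', map_add, map_neg, map_mul, zshear_X_of_ne (Ne.symm hvz), map_sub, map_one,
      map_add, map_mul, map_sub, zshear_X_self, zshear_of_varFree ζ₂ hζ₂, zshear_of_varFree ζ₂ hrg]
    ring
  · rw [zshear_X_of_ne hiz, hθi i hiz, map_mul, hτi z (Ne.symm hvz), hτi i hiv, map_mul,
      zshear_X_of_ne (Ne.symm hvz), zshear_X_of_ne hiv]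
    unfold rotSubst
    rw [aeval_X, if_neg hiu, if_neg hiv, if_neg hiz]
    ring

end Presentation

end Summit.ResolutionOfSingularities.ResolutionOfSingularities.Theorems.WallFrames
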